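import Mathlib

/-!
# Crux K2 `PoloidalWindowRigidity` (stmt-NavierStokesRegularity-19708), line `z_shock` — R3 inhabitant census (X): MONOTONE ONE-PHASE
# PROFILES — without boundedness the autonomous hyperbolic STRICTLY genuinely nonlinear height-evolution IS inhabited (explicit
# `sinh` witness; cubic polynomial slices `ξ³ + 3ξ`); the «GN alone» mechanism of parts I–IX stops at degree two

`--supports stmt-NavierStokesRegularity-19708 --as helper` (leafhand-ns-poloidalwindowdoor-3 g22, cell decomp-ns, 2026-09-01).  Class-free,
def-free, Mathlib only.  **No stub and no summit is closed by this file; Navier–Stokes regularity is NOT proved here (rung 0).**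

CONTEXT.  The deciding stub `stub_zShockThickAut` of the registered skeleton `Cruxes/PoloidalWindowRigidity/Lines/z_shock.lean` (sha16
c3e8eee2) is reduced in the tree to the class-free slice Liouville statement `hGN` (`…ZShockAutOfSliceLiouville`) about BOUNDED analytic
solutions with BOUNDED GRADIENT of the autonomous height-evolution `∂ₛ∂ₛW = γ(W)ΔW + γ'(W)|∇W|²` (`γ ≥ 0` hyperbolic, `γ' ≢ 0` THICK /
genuinely nonlinear).  The turning-shear series (parts I–IX, hands 3-g19 / 3-g21: `…ZShockTurningShear`, `…Quadratic`, `…Definite`,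
`…DefiniteHeights`, `…Indefinite`, `…Saddle`, `…Parabolic`, `…Aligned`, `…Synthesis`) showed that AFFINE and QUADRATIC slices are emptied by
genuine nonlinearity ALONE — no boundedness used — and queued «cubic / higher polynomial slices» as the next census item with the same
expected answer.  THIS FILE SETTLES THAT ITEM IN THE NEGATIVE and locates exactly where boundedness becomes load-bearing:

  ONE-PHASE MONOTONE PROFILES `W(s, t) = F(t − c·s)` (planar patterns `W(s, y) = F(y₀ − c s)` of the 2-D equation: `ΔW = F''`,
  `|∇W|² = F'²`) with `F ∈ C²`, `F' > 0`, `F(ℝ) = ℝ`.  For EVERY such profile and every `c ≠ 0`, `α > 0` the structure function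
  `γ(u) = c² + α·(F⁻¹)'(u) = c² + α / F'(F⁻¹(u))` is differentiable, uniformly hyperbolic (`γ > c²`), genuinely nonlinear wherever
  `F'' ≠ 0`, and the pattern solves the height-evolution AT EVERY HEIGHT `s ∈ ℝ`:
  `∂ₛ∂ₛW = c²F'' = γ(W)·F'' + γ'(W)·F'²` (the travelling-wave first integral `Γ(F(ξ)) = c²F(ξ) + αξ + β`, `Γ' = γ`, read backwards:
  the linear term `αξ`, which two-sided BOUNDEDNESS of the profile kills in the tree's rung `…ZShockTravellingRigid.onePhase_const_of_thick`,
  is exactly what an unbounded monotone profile can carry).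

* `hasDerivAt_inverseProfile`, `hasDerivAt_structureFunction` — calculus of `F⁻¹` and of `γ = c² + α/F'∘F⁻¹`
  (`γ' = −α F''(F⁻¹)/F'(F⁻¹)³`);
* ★ `onePhase_monotone_solves` (+ `onePhase_hasDerivAt`) — the identity above at every height, for every monotone one-phase profile;
* ★ `sinh_onePhase_inhabited` — the fully explicit witness `F = sinh`: `γ(u) = c² + α/√(1+u²)`, `γ'(u) = −αu/((1+u²)√(1+u²))`:
  differentiable on `ℝ`, `γ > c² > 0` (uniformly hyperbolic), `γ'(u) ≠ 0` for `u ≠ 0`, and STRICTLY genuinely nonlinear in the sense of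
  part IX (`γ'` is constant on NO interval — polynomial-identity argument), solving the height-evolution at every height;
* ★ `cubic_onePhase_inhabited` — the CUBIC POLYNOMIAL SLICE `W(s,t) = (t − cs)³ + 3(t − cs)` (a polynomial slice of degree three at every
  height) lives on a uniformly hyperbolic, strictly genuinely nonlinear column (`γ = c² + α/(3τ(u)² + 3)`, `τ = (ξ ↦ ξ³+3ξ)⁻¹` obtained from
  `StrictMono.orderIsoOfSurjective`; strictness again by a polynomial identity in `ξ`).

CONSEQUENCES FOR THE CENSUS (honest label).  (i) The expectation «strict GN + hyperbolic ⇒ every polynomial-slice pattern is horizontally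
trivial, no boundedness needed» (parts I–IX for degree ≤ 2) is FALSE from degree 3 on: monotone (critical-point-free) odd profiles are
inhabited.  Degree ≤ 2 is rigid precisely because no polynomial of degree ≤ 2 is a monotone bijection of `ℝ`.  (ii) The boundedness
hypothesis `|W| ≤ M` of `onePhase_const_of_thick` is load-bearing (tightness witness), and so are the clauses `‖u‖ ≤ M`, `‖∇u‖ ≤ M₁` of
`hGN`: none of the inhabitants here is bounded, so NOTHING here bears on `hGN` itself, which stays XL and not in print.  (iii) The next
census items must therefore carry boundedness (or at least sub-linear growth) from the start; «GN alone» is exhausted.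
presearch: travelling-wave reduction of `u_ss = (Γ(u))_tt` / p-system simple and travelling waves — textbook [folklore]; tree: `rg` over
`Theorems/…ZShock*` finds the bounded rung (`…TravellingRigid`, `…ScalarEternal.travellingWave_const`) and no unbounded inhabitant. [folklore]
-/

noncomputable section

namespace Summit.NavierStokesRegularity.NavierStokesRegularity.Theorems.PoloidalWindowDoorPoloidalWindowRigidityZShockTurningShearMonotone

-- the summit and its single sub-problem share the name (CONVENTIONS §1)
set_option linter.dupNamespace false

open Set Filter Topology

/-! ## Calculus of the inverse profile and of the structure function -/

/-- **Derivative of the inverse profile.**  If `F` is differentiable with `F' > 0` and `Finv` is a continuous right inverse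
(`F (Finv u) = u`), then `Finv` is differentiable with `Finv'(u) = 1 / F'(Finv u)`. [folklore] -/
theorem hasDerivAt_inverseProfile {F F' Finv : ℝ → ℝ} (hF : ∀ ξ, HasDerivAt F (F' ξ) ξ)
    (hpos : ∀ ξ, 0 < F' ξ) (hleft : ∀ u, F (Finv u) = u) (hFinv : Continuous Finv) (u : ℝ) :
    HasDerivAt Finv (F' (Finv u))⁻¹ u :=
  HasDerivAt.of_local_left_inverse hFinv.continuousAt (hF (Finv u)) (hpos _).ne'
    (Eventually.of_forall hleft)

/-- **The structure function of a monotone one-phase profile is differentiable.**  For `F ∈ C²` with `F' > 0` and a continuous right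
inverse `Finv`, the function `γ(u) = c² + α / F'(Finv u)` has derivative `γ'(u) = −α·F''(Finv u) / F'(Finv u)³` at every `u`.
[folklore] -/
theorem hasDerivAt_structureFunction {F F' F'' Finv : ℝ → ℝ} (hF : ∀ ξ, HasDerivAt F (F' ξ) ξ)
    (hF' : ∀ ξ, HasDerivAt F' (F'' ξ) ξ) (hpos : ∀ ξ, 0 < F' ξ) (hleft : ∀ u, F (Finv u) = u)
    (hFinv : Continuous Finv) (c α u : ℝ) :
    HasDerivAt (fun u => c ^ 2 + α / F' (Finv u)) (-(α * F'' (Finv u)) / F' (Finv u) ^ 3) u := by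
  have h1 : HasDerivAt (fun u => F' (Finv u)) (F'' (Finv u) * (F' (Finv u))⁻¹) u :=
    (hF' (Finv u)).comp u (hasDerivAt_inverseProfile hF hpos hleft hFinv u)
  have hne : F' (Finv u) ≠ 0 := (hpos _).ne'
  have h2 := ((hasDerivAt_const u α).div h1 hne).const_add (c ^ 2)
  refine h2.congr_deriv ?_
  field_simp
  ring

/-! ## One-phase monotone profiles solve the height-evolution -/

/-- **Derivatives of the one-phase pattern `W(s,t) = F(t − c s)`:** `∂ₛW = −cF'`, `∂ₛ∂ₛW = c²F''`, `∂ₜW = F'`, `∂ₜ∂ₜW = F''`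
(all evaluated at `ξ = t − cs`). [folklore] -/
theorem onePhase_hasDerivAt {F F' F'' : ℝ → ℝ} (hF : ∀ ξ, HasDerivAt F (F' ξ) ξ)
    (hF' : ∀ ξ, HasDerivAt F' (F'' ξ) ξ) (c s t : ℝ) :
    HasDerivAt (fun s => F (t - c * s)) (-c * F' (t - c * s)) s ∧
    HasDerivAt (fun s => -c * F' (t - c * s)) (c ^ 2 * F'' (t - c * s)) s ∧
    HasDerivAt (fun t => F (t - c * s)) (F' (t - c * s)) t ∧
    HasDerivAt (fun t => F' (t - c * s)) (F'' (t - c * s)) t := by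
  have hs : HasDerivAt (fun s : ℝ => t - c * s) (-c) s := by
    simpa using ((hasDerivAt_id s).const_mul c).const_sub t
  have ht : HasDerivAt (fun t : ℝ => t - c * s) 1 t := by
    simpa using (hasDerivAt_id t).sub_const (c * s)
  refine ⟨?_, ?_, ?_, ?_⟩
  · exact ((hF (t - c * s)).comp s hs).congr_deriv (by ring)
  · exact (((hF' (t - c * s)).comp s hs).const_mul (-c)).congr_deriv (by ring)
  · exact ((hF (t - c * s)).comp t ht).congr_deriv (by ring)
  · exact ((hF' (t - c * s)).comp t ht).congr_deriv (by ring)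

/-- ★ **Monotone one-phase profiles are inhabitants.**  Let `F' > 0` and let `Finv` be a left inverse of `F` (`Finv (F ξ) = ξ`).  With
`γ(u) = c² + α / F'(Finv u)` and `γ'(u) = −α F''(Finv u)/F'(Finv u)³` (its derivative, `hasDerivAt_structureFunction`), the pattern
`W(s,t) = F(t − cs)` satisfies the autonomous height-evolution `∂ₛ∂ₛW = γ(W)∂ₜ∂ₜW + γ'(W)(∂ₜW)²` at EVERY height:
`c²F''(ξ) = γ(F ξ)F''(ξ) + γ'(F ξ)F'(ξ)²`, `ξ = t − cs` (planar 2-D reading: `ΔW = F''`, `|∇W|² = F'²`).  No hypothesis on `γ'`: the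
column may be as genuinely nonlinear as `F''` allows. [folklore] -/
theorem onePhase_monotone_solves {F F' Finv : ℝ → ℝ} (F'' : ℝ → ℝ) (hright : ∀ ξ, Finv (F ξ) = ξ)
    (hpos : ∀ ξ, 0 < F' ξ) (c α s t : ℝ) :
    c ^ 2 * F'' (t - c * s) =
      (fun u => c ^ 2 + α / F' (Finv u)) (F (t - c * s)) * F'' (t - c * s) +
        (fun u => -(α * F'' (Finv u)) / F' (Finv u) ^ 3) (F (t - c * s)) * F' (t - c * s) ^ 2 := by
  simp only [hright]
  have hne : F' (t - c * s) ≠ 0 := (hpos _).ne'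
  field_simp
  ring

/-! ## The explicit witness `F = sinh`: `γ(u) = c² + α/√(1+u²)` -/

/-- ★ **The `sinh` one-phase inhabitant, fully explicit.**  For `α > 0` and any `c`, the structure function `γ(u) = c² + α/√(1 + u²)`
with `γ'(u) = −αu/((1+u²)√(1+u²))`: (1) `γ` is differentiable on `ℝ` with derivative `γ'`; (2) `γ > c²` (uniformly hyperbolic when
`c ≠ 0`); (3) `γ'(u) ≠ 0` for `u ≠ 0` (genuinely nonlinear off one value); (4) `γ'` is constant on NO nontrivial interval (STRICT genuine
nonlinearity, the hypothesis `hstrict` of part IX); (5) the pattern `W(s,t) = sinh(t − cs)` solves the height-evolution at every height: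
`c²·sinh ξ = γ(sinh ξ)·sinh ξ + γ'(sinh ξ)·cosh²ξ`.  So on this hyperbolic strictly-GN column a non-constant entire pattern exists at all
heights — unbounded, as it must be by `…ZShockTravellingRigid.onePhase_const_of_thick`. [folklore] -/
theorem sinh_onePhase_inhabited (c α : ℝ) (hα : 0 < α) :
    (∀ u, HasDerivAt (fun u : ℝ => c ^ 2 + α / √(1 + u ^ 2)) (-(α * u) / ((1 + u ^ 2) * √(1 + u ^ 2))) u) ∧
    (∀ u : ℝ, c ^ 2 < c ^ 2 + α / √(1 + u ^ 2)) ∧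
    (∀ u : ℝ, u ≠ 0 → -(α * u) / ((1 + u ^ 2) * √(1 + u ^ 2)) ≠ 0) ∧
    (∀ p q k : ℝ, p < q → ∃ u, p < u ∧ u < q ∧ -(α * u) / ((1 + u ^ 2) * √(1 + u ^ 2)) ≠ k) ∧
    (∀ s t : ℝ, c ^ 2 * Real.sinh (t - c * s) =
      (c ^ 2 + α / √(1 + Real.sinh (t - c * s) ^ 2)) * Real.sinh (t - c * s) +
        -(α * Real.sinh (t - c * s)) / ((1 + Real.sinh (t - c * s) ^ 2) * √(1 + Real.sinh (t - c * s) ^ 2)) *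
          Real.cosh (t - c * s) ^ 2) := by
  refine ⟨fun u => ?_, fun u => ?_, fun u hu => ?_, fun p q k hpq => ?_, fun s t => ?_⟩
  · -- (1) differentiability
    have h0 : 0 < 1 + u ^ 2 := by positivity
    have h1 : HasDerivAt (fun u : ℝ => 1 + u ^ 2) (2 * u) u := by
      have := ((hasDerivAt_id' u).pow 2).const_add 1
      exact this.congr_deriv (by push_cast; ring)
    have h2 : HasDerivAt (fun u : ℝ => √(1 + u ^ 2)) (2 * u / (2 * √(1 + u ^ 2))) u := h1.sqrt h0.ne'
    have hsq : √(1 + u ^ 2) ≠ 0 := (Real.sqrt_pos.2 h0).ne'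
    have h3 := ((hasDerivAt_const u α).div h2 hsq).const_add (c ^ 2)
    refine h3.congr_deriv ?_
    have hs : √(1 + u ^ 2) ^ 2 = 1 + u ^ 2 := Real.sq_sqrt h0.le
    rw [hs]
    field_simp
    ring
  · -- (2) hyperbolicity
    have h0 : 0 < 1 + u ^ 2 := by positivity
    exact lt_add_of_pos_right _ (div_pos hα (Real.sqrt_pos.2 h0))
  · -- (3) genuine nonlinearity off `u = 0`
    have h0 : 0 < 1 + u ^ 2 := by positivity
    have hsq : √(1 + u ^ 2) ≠ 0 := (Real.sqrt_pos.2 h0).ne'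
    exact div_ne_zero (neg_ne_zero.2 (mul_ne_zero hα.ne' hu)) (mul_ne_zero h0.ne' hsq)
  · -- (4) strict genuine nonlinearity: `γ'` is constant on no interval
    by_contra hcon0
    have hcon : ∀ u, p < u → u < q → -(α * u) / ((1 + u ^ 2) * √(1 + u ^ 2)) = k :=
      fun u h1 h2 => by by_contra h; exact hcon0 ⟨u, h1, h2, h⟩
    have hsq : ∀ u, p < u → u < q → k ^ 2 * (1 + u ^ 2) ^ 3 = α ^ 2 * u ^ 2 := by
      intro u hpu huq
      have h := hcon u hpu huq
      have h1 : 0 < 1 + u ^ 2 := by positivity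
      have h2 : 0 < √(1 + u ^ 2) := Real.sqrt_pos.2 h1
      have h3 : √(1 + u ^ 2) ^ 2 = 1 + u ^ 2 := Real.sq_sqrt h1.le
      have h4 : k * ((1 + u ^ 2) * √(1 + u ^ 2)) = -(α * u) := by
        rw [← h]
        field_simp
      calc k ^ 2 * (1 + u ^ 2) ^ 3 = (k * ((1 + u ^ 2) * √(1 + u ^ 2))) ^ 2 := by rw [mul_pow, mul_pow, h3]; ring
        _ = α ^ 2 * u ^ 2 := by rw [h4]; ring
    -- the polynomial `k²(1+X²)³ − α²X²` vanishes on `(p,q)`, hence identically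
    have heval : ∀ u : ℝ, (Polynomial.C (k ^ 2) * (1 + Polynomial.X ^ 2) ^ 3 -
        Polynomial.C (α ^ 2) * Polynomial.X ^ 2 : Polynomial ℝ).eval u = k ^ 2 * (1 + u ^ 2) ^ 3 - α ^ 2 * u ^ 2 := by
      intro u
      simp only [Polynomial.eval_sub, Polynomial.eval_mul, Polynomial.eval_C, Polynomial.eval_pow,
        Polynomial.eval_add, Polynomial.eval_one, Polynomial.eval_X]
    have hP0 : (Polynomial.C (k ^ 2) * (1 + Polynomial.X ^ 2) ^ 3 -
        Polynomial.C (α ^ 2) * Polynomial.X ^ 2 : Polynomial ℝ) = 0 := by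
      refine Polynomial.eq_zero_of_infinite_isRoot _ ((Set.Ioo_infinite hpq).mono ?_)
      intro u hu
      show Polynomial.eval u _ = 0
      rw [heval, hsq u hu.1 hu.2]
      ring
    have hk : k = 0 := by
      have h := heval 0
      rw [hP0, Polynomial.eval_zero] at h
      have : k ^ 2 = 0 := by nlinarith [h]
      exact pow_eq_zero_iff two_ne_zero |>.mp this
    obtain ⟨u₀, hpu, huq, hu0⟩ : ∃ u₀, p < u₀ ∧ u₀ < q ∧ u₀ ≠ 0 := by
      by_cases h : (2 * p + q) / 3 = 0
      · refine ⟨(p + 2 * q) / 3, by linarith, by linarith, fun h' => hpq.ne ?_⟩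
        linarith
      · exact ⟨(2 * p + q) / 3, by linarith, by linarith, h⟩
    have h1 := hsq u₀ hpu huq
    rw [hk] at h1
    have h2 : α ^ 2 * u₀ ^ 2 ≠ 0 := by positivity
    exact h2 (by linarith [h1])
  · -- (5) the identity at every height
    set ξ : ℝ := t - c * s with hξ
    have hc : 0 < Real.cosh ξ := Real.cosh_pos ξ
    have h1 : 1 + Real.sinh ξ ^ 2 = Real.cosh ξ ^ 2 := by rw [Real.cosh_sq]; ring
    have h2 : √(1 + Real.sinh ξ ^ 2) = Real.cosh ξ := by rw [h1, Real.sqrt_sq hc.le]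
    rw [h2, h1]
    field_simp
    ring

/-! ## The cubic polynomial slice `ξ³ + 3ξ` -/

/-- ★ **Cubic polynomial slices are inhabited (no boundedness ⇒ no rigidity at degree three).**  For `α > 0` and any `c` there is a
differentiable structure function `γ` with derivative `γ'` such that `γ > c²` (uniformly hyperbolic for `c ≠ 0`), `γ'` is constant on
NO interval (strict genuine nonlinearity), and the cubic one-phase pattern `W(s,t) = (t − cs)³ + 3(t − cs)` — a polynomial slice of degree
three at EVERY height — solves the autonomous height-evolution at every height:
`∂ₛ∂ₛW = c²·6ξ = γ(W)·6ξ + γ'(W)·(3ξ² + 3)²`, `ξ = t − cs`.  (`γ = c² + α/(3τ² + 3)∘τ`, `τ` the inverse of `ξ ↦ ξ³ + 3ξ`.)  So the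
single-height / all-heights rigidity of polynomial slices established for degree ≤ 2 in parts I–IX does not extend to degree 3 without a
boundedness hypothesis. [folklore] -/
theorem cubic_onePhase_inhabited (c α : ℝ) (hα : 0 < α) :
    ∃ γ γ' : ℝ → ℝ,
      (∀ u, HasDerivAt γ (γ' u) u) ∧
      (∀ u, c ^ 2 < γ u) ∧
      (∀ p q k : ℝ, p < q → ∃ u, p < u ∧ u < q ∧ γ' u ≠ k) ∧
      (∀ s t : ℝ, c ^ 2 * (6 * (t - c * s)) =
        γ ((t - c * s) ^ 3 + 3 * (t - c * s)) * (6 * (t - c * s)) +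
          γ' ((t - c * s) ^ 3 + 3 * (t - c * s)) * (3 * (t - c * s) ^ 2 + 3) ^ 2) := by
  -- the profile, its derivatives, monotonicity and surjectivity
  have hF : ∀ ξ : ℝ, HasDerivAt (fun ξ : ℝ => ξ ^ 3 + 3 * ξ) (3 * ξ ^ 2 + 3) ξ := fun ξ =>
    (((hasDerivAt_id' ξ).pow 3).add ((hasDerivAt_id' ξ).const_mul 3)).congr_deriv (by push_cast; ring)
  have hF' : ∀ ξ : ℝ, HasDerivAt (fun ξ : ℝ => 3 * ξ ^ 2 + 3) (6 * ξ) ξ := fun ξ =>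
    ((((hasDerivAt_id' ξ).pow 2).const_mul 3).add_const 3).congr_deriv (by push_cast; ring)
  have hpos : ∀ ξ : ℝ, 0 < 3 * ξ ^ 2 + 3 := fun ξ => by positivity
  have hmono : StrictMono (fun ξ : ℝ => ξ ^ 3 + 3 * ξ) :=
    strictMono_of_deriv_pos fun ξ => by rw [(hF ξ).deriv]; exact hpos ξ
  have hcont : Continuous (fun ξ : ℝ => ξ ^ 3 + 3 * ξ) := by fun_prop
  have htop : Tendsto (fun ξ : ℝ => ξ ^ 3 + 3 * ξ) atTop atTop := by
    refine tendsto_atTop_mono' atTop ?_ tendsto_id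
    filter_upwards [eventually_ge_atTop (0 : ℝ)] with ξ hξ
    have : 0 ≤ ξ ^ 3 := by positivity
    show ξ ≤ ξ ^ 3 + 3 * ξ
    linarith
  have hbot : Tendsto (fun ξ : ℝ => ξ ^ 3 + 3 * ξ) atBot atBot := by
    refine tendsto_atBot_mono' atBot ?_ tendsto_id
    filter_upwards [eventually_le_atBot (0 : ℝ)] with ξ hξ
    have : ξ ^ 3 ≤ 0 := by
      have h3 : ξ ^ 3 = ξ * ξ ^ 2 := by ring
      rw [h3]
      exact mul_nonpos_of_nonpos_of_nonneg hξ (sq_nonneg ξ)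
    show ξ ^ 3 + 3 * ξ ≤ ξ
    linarith
  have hsurj : Function.Surjective (fun ξ : ℝ => ξ ^ 3 + 3 * ξ) := hcont.surjective htop hbot
  -- the inverse profile `τ`
  set Φ : ℝ ≃o ℝ := hmono.orderIsoOfSurjective _ hsurj with hΦ_def
  have hΦ : ∀ ξ, Φ ξ = ξ ^ 3 + 3 * ξ := fun ξ => by
    rw [hΦ_def, StrictMono.coe_orderIsoOfSurjective]
  have hleft : ∀ u, Φ.symm u ^ 3 + 3 * Φ.symm u = u := fun u => by
    have h := Φ.apply_symm_apply u
    rw [hΦ] at h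
    exact h
  have hright : ∀ ξ, Φ.symm (ξ ^ 3 + 3 * ξ) = ξ := fun ξ => by
    have h := Φ.symm_apply_apply ξ
    rw [hΦ] at h
    exact h
  have hΦc : Continuous (fun u => Φ.symm u) := Φ.symm.continuous
  refine ⟨fun u => c ^ 2 + α / (3 * Φ.symm u ^ 2 + 3), fun u => -(α * (6 * Φ.symm u)) / (3 * Φ.symm u ^ 2 + 3) ^ 3,
    fun u => ?_, fun u => ?_, fun p q k hpq => ?_, fun s t => ?_⟩
  · -- differentiability
    exact hasDerivAt_structureFunction (F := fun ξ : ℝ => ξ ^ 3 + 3 * ξ) (F' := fun ξ : ℝ => 3 * ξ ^ 2 + 3)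
      (F'' := fun ξ : ℝ => 6 * ξ) (Finv := fun u => Φ.symm u) hF hF' hpos hleft hΦc c α u
  · -- hyperbolicity
    exact lt_add_of_pos_right _ (div_pos hα (hpos _))
  · -- strict genuine nonlinearity, read through the profile: `γ'(F ξ) = −6αξ/(3ξ²+3)³`
    by_contra hcon0
    have hcon : ∀ u, p < u → u < q → -(α * (6 * Φ.symm u)) / (3 * Φ.symm u ^ 2 + 3) ^ 3 = k :=
      fun u h1 h2 => by by_contra h; exact hcon0 ⟨u, h1, h2, h⟩
    -- the `ξ`-interval `(Φ.symm p, Φ.symm q)` is mapped into `(p, q)`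
    have hab : Φ.symm p < Φ.symm q := Φ.symm.strictMono hpq
    have hξ : ∀ ξ, Φ.symm p < ξ → ξ < Φ.symm q → k * (3 * ξ ^ 2 + 3) ^ 3 + 6 * α * ξ = 0 := by
      intro ξ h1 h2
      have hp' : p < ξ ^ 3 + 3 * ξ := by
        have := hmono h1
        simp only at this
        rwa [hleft] at this
      have hq' : ξ ^ 3 + 3 * ξ < q := by
        have := hmono h2
        simp only at this
        rwa [hleft] at this
      have h := hcon (ξ ^ 3 + 3 * ξ) hp' hq'
      have hr : Φ.symm (ξ ^ 3 + 3 * ξ) = ξ := hright ξ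
      rw [hr] at h
      have hne : (3 * ξ ^ 2 + 3) ^ 3 ≠ 0 := pow_ne_zero 3 (hpos ξ).ne'
      rw [← h]
      field_simp
      ring
    have heval : ∀ ξ : ℝ, (Polynomial.C k * (Polynomial.C 3 * Polynomial.X ^ 2 + Polynomial.C 3) ^ 3 +
        Polynomial.C (6 * α) * Polynomial.X : Polynomial ℝ).eval ξ = k * (3 * ξ ^ 2 + 3) ^ 3 + 6 * α * ξ := by
      intro ξ
      simp only [Polynomial.eval_add, Polynomial.eval_mul, Polynomial.eval_C, Polynomial.eval_pow,
        Polynomial.eval_X]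
    have hP0 : (Polynomial.C k * (Polynomial.C 3 * Polynomial.X ^ 2 + Polynomial.C 3) ^ 3 +
        Polynomial.C (6 * α) * Polynomial.X : Polynomial ℝ) = 0 := by
      refine Polynomial.eq_zero_of_infinite_isRoot _ ((Set.Ioo_infinite hab).mono ?_)
      intro ξ hξ'
      show Polynomial.eval ξ _ = 0
      rw [heval]
      exact hξ ξ hξ'.1 hξ'.2
    have hk : k = 0 := by
      have h := heval 0
      rw [hP0, Polynomial.eval_zero] at h
      norm_num at h
      linarith [h]
    obtain ⟨ξ₀, h1, h2, h0⟩ : ∃ ξ₀, Φ.symm p < ξ₀ ∧ ξ₀ < Φ.symm q ∧ ξ₀ ≠ 0 := by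
      by_cases h : (2 * Φ.symm p + Φ.symm q) / 3 = 0
      · refine ⟨(Φ.symm p + 2 * Φ.symm q) / 3, by linarith, by linarith, fun h' => hab.ne ?_⟩
        linarith
      · exact ⟨(2 * Φ.symm p + Φ.symm q) / 3, by linarith, by linarith, h⟩
    have h3 := hξ ξ₀ h1 h2
    rw [hk] at h3
    have h4 : 6 * α * ξ₀ ≠ 0 := mul_ne_zero (mul_ne_zero (by norm_num) hα.ne') h0
    exact h4 (by linarith [h3])
  · -- the identity at every height
    have h := onePhase_monotone_solves (F := fun ξ : ℝ => ξ ^ 3 + 3 * ξ) (F' := fun ξ : ℝ => 3 * ξ ^ 2 + 3)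
      (Finv := fun u => Φ.symm u) (fun ξ : ℝ => 6 * ξ) hright hpos c α s t
    simpa only using h

end Summit.NavierStokesRegularity.NavierStokesRegularity.Theorems.PoloidalWindowDoorPoloidalWindowRigidityZShockTurningShearMonotone

end
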